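import Mathlib.Geometry.Euclidean.Inversion.Basic
import Mathlib.Topology.Compactification.OnePoint.Basic
import Mathlib.Analysis.Calculus.Deriv.Basic
import Mathlib.AlgebraicTopology.FundamentalGroupoid.SimplyConnected
import Mathlib.Analysis.SpecialFunctions.Pow.Real
import Mathlib.Analysis.InnerProductSpace.PiL2
import Literature.Probability.LatticeModels.ScalingLimit
import HarnessLib

-- provenance: harness21/H21/H21/Prelude/StatMech/ConformalCovariance.lean @ d6ac5b2 (interim HEAD d8f2665); M5 mechanical rewrite
/-!
# Möbius / conformal covariance of correlation families

Trunk: StatMech (prelude item P9 `ConformalCovariance`, design decision D4; notions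
`mobius_conformal_group_Rd`, `conformal_covariance_correlators`).

For a continuum family of `n`-point functions `S : CorrFamily d` on `ℝ^d` (see
`Literature.Prelude.StatMech.ScalingLimit`) and a scaling dimension `Δ : ℝ` we define the covariance
predicates under the generators of the Möbius (global conformal) group of `ℝ^d ∪ {∞}`:
translations, orthogonal maps, dilations `x ↦ λ x` (factor `λ^{-nΔ}`) and the unit inversion
`x ↦ x/‖x‖²` (factor `∏ᵢ ‖xᵢ‖^{2Δ}`), cf. Di Francesco–Mathieu–Sénéchal, *Conformal Field Theory*
(Springer 1997), §4.1 (conformal group in `d ≥ 3` dimensions, generated by these maps) and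
§4.3.1, eq. (4.62) (covariance of quasi-primary correlators
`⟨φ(x₁')⋯φ(xₙ')⟩ = ∏ |∂x'/∂x|_{xᵢ}^{-Δ/d} ⟨φ(x₁)⋯φ(xₙ)⟩`). `IsMoebiusCovariant Δ S` is the
conjunction. To realise the notion `mobius_conformal_group_Rd` we also build the Möbius group
`moebiusGroup d ≤ Equiv.Perm (OnePoint (ℝ^d))` as the subgroup generated by the unit inversion
(swapping `0` and `∞`) and the similarities `x ↦ c • R x + v`; no target statement uses it.

Planar case (Chelkak–Hongler–Izyurov, *Conformal invariance of spin correlations in the planar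
Ising model*, Ann. Math. 181 (2015), Thm 1.2): families indexed by a domain `Ω ⊆ ℂ`,
`S Ω n (a₁,…,aₙ)`, and covariance under conformal bijections `φ : Ω → Ω'` with factor
`∏ᵢ |φ'(aᵢ)|^{-Δ}`.

Mathlib anchors used (searched): `EuclideanGeometry.inversion` and `inversion_inversion`
(Geometry/Euclidean/Inversion/Basic.lean), `OnePoint` (Topology/Compactification/OnePoint),
`LinearIsometryEquiv`, `Subgroup.closure`, `Function.Involutive.toPerm`, `Equiv.optionCongr`,
`Real.rpow`, `DifferentiableOn`, `Set.BijOn`, `deriv`, `IsSimplyConnected`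
(AlgebraicTopology/FundamentalGroupoid/SimplyConnected.lean:137), `Bornology.IsBounded`. Mathlib
has no Möbius group of `ℝ^d` (only `UpperHalfPlane.MoebiusAction` of `SL(2,ℝ)` on `ℍ`) and no
covariance predicates for correlation functions.

Design choices: "rotations" are all linear isometries `ℝ^d ≃ₗᵢ[ℝ] ℝ^d`, i.e. `O(d)` including
reflections (the standard convention for the Euclidean group in CFT). Scale factors use
`Real.rpow`. The inversion predicate is only required at configurations avoiding the origin.
The Möbius group acts on the one-point compactification `OnePoint (ℝ^d)` by permutations; we do
not topologise the action.
-/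

namespace Literature.Probability.LatticeModels

open EuclideanGeometry

variable {d : ℕ}

/-! ### Covariance predicates for correlation families on `ℝ^d` -/

/-- Translation invariance of a correlation family: `S n (x₁+v, …, xₙ+v) = S n (x₁, …, xₙ)` for
all `v ∈ ℝ^d`. (This is the correlation-family notion; the measure-level notion is
`IsTranslationInvariantMeasure`.) (Di Francesco–Mathieu–Sénéchal 1997, §4.3.1.) [cite: FrancescoMathieuSenechal1997, §4.3.1] -/
def IsTranslationInvariant (S : CorrFamily d) : Prop :=
  ∀ n (v : EuclideanSpace ℝ (Fin d)) (x : Fin n → EuclideanSpace ℝ (Fin d)),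
    S n (fun i => x i + v) = S n x

/-- Rotation (orthogonal) invariance of a correlation family: `S n (R x₁, …, R xₙ) = S n x` for
every linear isometry `R ∈ O(d)` (reflections included).
(Di Francesco–Mathieu–Sénéchal 1997, §4.3.1.) [cite: FrancescoMathieuSenechal1997, §4.3.1] -/
def IsRotationInvariant (S : CorrFamily d) : Prop :=
  ∀ n (R : EuclideanSpace ℝ (Fin d) ≃ₗᵢ[ℝ] EuclideanSpace ℝ (Fin d))
    (x : Fin n → EuclideanSpace ℝ (Fin d)), S n (fun i => R (x i)) = S n x

/-- Euclidean invariance: invariance under translations and orthogonal maps.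
(Di Francesco–Mathieu–Sénéchal 1997, §4.3.1.) [cite: FrancescoMathieuSenechal1997, §4.3.1] -/
def IsEuclideanInvariant (S : CorrFamily d) : Prop :=
  IsTranslationInvariant S ∧ IsRotationInvariant S

/-- Scale covariance with scaling dimension `Δ`: for every `λ > 0`,
`S n (λx₁, …, λxₙ) = λ^{-nΔ} S n (x₁, …, xₙ)`.
(Di Francesco–Mathieu–Sénéchal 1997, §4.3.1, eq. (4.62) for dilations.) [cite: FrancescoMathieuSenechal1997, §4.3.1  eq. (4.62] -/
def IsScaleCovariant (Δ : ℝ) (S : CorrFamily d) : Prop :=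
  ∀ n (c : ℝ), 0 < c → ∀ x : Fin n → EuclideanSpace ℝ (Fin d),
    S n (fun i => c • x i) = c ^ (-(n : ℝ) * Δ) * S n x

/-- Covariance under the unit inversion `x ↦ x/‖x‖²` (`EuclideanGeometry.inversion 0 1`) with
scaling dimension `Δ`: for configurations avoiding the origin,
`S n (x₁/‖x₁‖², …, xₙ/‖xₙ‖²) = (∏ᵢ ‖xᵢ‖^{2Δ}) S n x` (the conformal factor of the inversion at
`x` is `‖x‖^{-2}`). (Di Francesco–Mathieu–Sénéchal 1997, §4.1 eq. (4.15) and §4.3.1 eq. (4.62).) [cite: FrancescoMathieuSenechal1997, §4.1 eq. (4.15] -/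
def IsInversionCovariant (Δ : ℝ) (S : CorrFamily d) : Prop :=
  ∀ n (x : Fin n → EuclideanSpace ℝ (Fin d)), (∀ i, x i ≠ 0) →
    S n (fun i => inversion 0 1 (x i)) = (∏ i, ‖x i‖ ^ (2 * Δ)) * S n x

/-- Möbius (global conformal) covariance with scaling dimension `Δ`: Euclidean invariance, scale
covariance and inversion covariance, i.e. covariance under a generating set of the Möbius group
of `ℝ^d ∪ {∞}`. (Di Francesco–Mathieu–Sénéchal 1997, §4.1 and §4.3.1 eq. (4.62);
summits/crit-ising3d/SUMMIT.md 'S' (ii).) [cite: FrancescoMathieuSenechal1997, §4.1 and §4.3.1 eq. (4.62] -/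
def IsMoebiusCovariant (Δ : ℝ) (S : CorrFamily d) : Prop :=
  IsEuclideanInvariant S ∧ IsScaleCovariant Δ S ∧ IsInversionCovariant Δ S

/-- A Möbius-covariant family is scale covariant. (Immediate from the definition;
Di Francesco–Mathieu–Sénéchal 1997, §4.3.1.) [cite: FrancescoMathieuSenechal1997, §4.3.1] -/
theorem IsMoebiusCovariant.isScaleCovariant {Δ : ℝ} {S : CorrFamily d}
    (h : IsMoebiusCovariant Δ S) : IsScaleCovariant Δ S :=
  h.2.1

/-- A Möbius-covariant family is Euclidean invariant. (Immediate from the definition;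
Di Francesco–Mathieu–Sénéchal 1997, §4.3.1.) [cite: FrancescoMathieuSenechal1997, §4.3.1] -/
theorem IsMoebiusCovariant.isEuclideanInvariant {Δ : ℝ} {S : CorrFamily d}
    (h : IsMoebiusCovariant Δ S) : IsEuclideanInvariant S :=
  h.1

/-- A Möbius-covariant family is inversion covariant. (Immediate from the definition;
Di Francesco–Mathieu–Sénéchal 1997, §4.3.1.) [cite: FrancescoMathieuSenechal1997, §4.3.1] -/
theorem IsMoebiusCovariant.isInversionCovariant {Δ : ℝ} {S : CorrFamily d}
    (h : IsMoebiusCovariant Δ S) : IsInversionCovariant Δ S :=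
  h.2.2

/-! ### The Möbius group of `ℝ^d ∪ {∞}` -/

/-- The unit inversion `x ↦ x/‖x‖²` extended to the one-point compactification `ℝ^d ∪ {∞}` by
`0 ↦ ∞`, `∞ ↦ 0`. (Di Francesco–Mathieu–Sénéchal 1997, §4.1, special conformal
transformations / inversion.) [cite: FrancescoMathieuSenechal1997, §4.1  special conformal transformations] -/
noncomputable def inversionFun (d : ℕ) :
    OnePoint (EuclideanSpace ℝ (Fin d)) → OnePoint (EuclideanSpace ℝ (Fin d)) :=
  fun z => z.elim ((0 : EuclideanSpace ℝ (Fin d)) : OnePoint (EuclideanSpace ℝ (Fin d)))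
    fun x => if x = 0 then OnePoint.infty else (inversion 0 1 x : EuclideanSpace ℝ (Fin d))

/-- The extended inversion sends `∞` to `0`. (Di Francesco–Mathieu–Sénéchal 1997, §4.1.) [cite: FrancescoMathieuSenechal1997, §4.1] -/
@[simp] theorem inversionFun_infty (d : ℕ) :
    inversionFun d OnePoint.infty = ((0 : EuclideanSpace ℝ (Fin d)) : OnePoint _) := rfl

/-- The extended inversion sends `0` to `∞`. (Di Francesco–Mathieu–Sénéchal 1997, §4.1.) [cite: FrancescoMathieuSenechal1997, §4.1] -/
@[simp] theorem inversionFun_zero (d : ℕ) :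
    inversionFun d ((0 : EuclideanSpace ℝ (Fin d)) : OnePoint _) = OnePoint.infty := by
  simp [inversionFun]

/-- Away from the origin the extended inversion is `EuclideanGeometry.inversion 0 1`.
(Di Francesco–Mathieu–Sénéchal 1997, §4.1.) [cite: FrancescoMathieuSenechal1997, §4.1] -/
theorem inversionFun_coe_of_ne_zero {x : EuclideanSpace ℝ (Fin d)} (hx : x ≠ 0) :
    inversionFun d (x : OnePoint _) = (inversion 0 1 x : EuclideanSpace ℝ (Fin d)) := by
  simp [inversionFun, hx]

/-- The extended unit inversion is an involution of `ℝ^d ∪ {∞}`.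
(Di Francesco–Mathieu–Sénéchal 1997, §4.1; Mathlib `EuclideanGeometry.inversion_inversion`.) [cite: FrancescoMathieuSenechal1997, §4.1] -/
theorem inversionFun_involutive (d : ℕ) : Function.Involutive (inversionFun d) := by
  intro z
  induction z using OnePoint.rec with
  | infty => simp
  | coe x =>
    by_cases hx : x = 0
    · subst hx; simp
    · have hx' : inversion (0 : EuclideanSpace ℝ (Fin d)) 1 x ≠ 0 := by
        rwa [Ne, inversion_eq_center one_ne_zero]
      rw [inversionFun_coe_of_ne_zero hx, inversionFun_coe_of_ne_zero hx',
        inversion_inversion _ one_ne_zero]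

/-- The unit inversion of `ℝ^d ∪ {∞}` (`x ↦ x/‖x‖²`, `0 ↔ ∞`) as a permutation.
(Di Francesco–Mathieu–Sénéchal 1997, §4.1.) [cite: FrancescoMathieuSenechal1997, §4.1] -/
noncomputable def inversionPerm (d : ℕ) : Equiv.Perm (OnePoint (EuclideanSpace ℝ (Fin d))) :=
  (inversionFun_involutive d).toPerm _

/-- The unit inversion permutation is an involution. (Di Francesco–Mathieu–Sénéchal 1997,
§4.1.) [cite: FrancescoMathieuSenechal1997, §4.1] -/
theorem inversionPerm_involutive (d : ℕ) : Function.Involutive (inversionPerm d) :=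
  inversionFun_involutive d

/-- The similarity `x ↦ c • R x + v` of `ℝ^d` (`c ≠ 0`, `R ∈ O(d)`, `v ∈ ℝ^d`) as a
self-equivalence of `ℝ^d`. (Di Francesco–Mathieu–Sénéchal 1997, §4.1: translations, dilations,
rigid rotations.) [cite: FrancescoMathieuSenechal1997, §4.1: translations  dilations  rigid rot] -/
noncomputable def similarityEquiv (c : ℝ) (hc : c ≠ 0)
    (R : EuclideanSpace ℝ (Fin d) ≃ₗᵢ[ℝ] EuclideanSpace ℝ (Fin d)) (v : EuclideanSpace ℝ (Fin d)) :
    Equiv.Perm (EuclideanSpace ℝ (Fin d)) where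
  toFun x := c • R x + v
  invFun y := R.symm (c⁻¹ • (y - v))
  left_inv x := by simp [smul_smul, inv_mul_cancel₀ hc]
  right_inv y := by simp [smul_smul, mul_inv_cancel₀ hc]

/-- Unfolding of `similarityEquiv`. (Di Francesco–Mathieu–Sénéchal 1997, §4.1.) [cite: FrancescoMathieuSenechal1997, §4.1] -/
@[simp] theorem similarityEquiv_apply (c : ℝ) (hc : c ≠ 0)
    (R : EuclideanSpace ℝ (Fin d) ≃ₗᵢ[ℝ] EuclideanSpace ℝ (Fin d))
    (v x : EuclideanSpace ℝ (Fin d)) : similarityEquiv c hc R v x = c • R x + v := rfl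

/-- The similarity `x ↦ c • R x + v` extended to `ℝ^d ∪ {∞}` by `∞ ↦ ∞`, as a permutation.
(Di Francesco–Mathieu–Sénéchal 1997, §4.1.) [cite: FrancescoMathieuSenechal1997, §4.1] -/
noncomputable def similarityPerm (c : ℝ) (hc : c ≠ 0)
    (R : EuclideanSpace ℝ (Fin d) ≃ₗᵢ[ℝ] EuclideanSpace ℝ (Fin d)) (v : EuclideanSpace ℝ (Fin d)) :
    Equiv.Perm (OnePoint (EuclideanSpace ℝ (Fin d))) :=
  Equiv.optionCongr (similarityEquiv c hc R v)

/-- Similarities fix `∞`. (Di Francesco–Mathieu–Sénéchal 1997, §4.1.) [cite: FrancescoMathieuSenechal1997, §4.1] -/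
@[simp] theorem similarityPerm_infty (c : ℝ) (hc : c ≠ 0)
    (R : EuclideanSpace ℝ (Fin d) ≃ₗᵢ[ℝ] EuclideanSpace ℝ (Fin d)) (v : EuclideanSpace ℝ (Fin d)) :
    similarityPerm c hc R v OnePoint.infty = OnePoint.infty := rfl

/-- Similarities act on finite points by `x ↦ c • R x + v`.
(Di Francesco–Mathieu–Sénéchal 1997, §4.1.) [cite: FrancescoMathieuSenechal1997, §4.1] -/
@[simp] theorem similarityPerm_coe (c : ℝ) (hc : c ≠ 0)
    (R : EuclideanSpace ℝ (Fin d) ≃ₗᵢ[ℝ] EuclideanSpace ℝ (Fin d))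
    (v x : EuclideanSpace ℝ (Fin d)) :
    similarityPerm c hc R v (x : OnePoint _) = ((c • R x + v : EuclideanSpace ℝ (Fin d)) :
      OnePoint _) := rfl

/-- The Möbius (global conformal) group of `ℝ^d ∪ {∞}`: the subgroup of permutations of the
one-point compactification generated by the similarities `x ↦ c • R x + v` and the unit
inversion. For `d ≥ 3` this is the full conformal group (Liouville), isomorphic to
`SO(d+1,1)` up to components. (Di Francesco–Mathieu–Sénéchal 1997, §4.1, eqs. (4.13)–(4.19).) [cite: FrancescoMathieuSenechal1997, §4.1  eqs. (4.13] -/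
noncomputable def moebiusGroup (d : ℕ) :
    Subgroup (Equiv.Perm (OnePoint (EuclideanSpace ℝ (Fin d)))) :=
  Subgroup.closure
    ({inversionPerm d} ∪
      {φ | ∃ (c : ℝ) (hc : c ≠ 0) (R : EuclideanSpace ℝ (Fin d) ≃ₗᵢ[ℝ] EuclideanSpace ℝ (Fin d))
        (v : EuclideanSpace ℝ (Fin d)), φ = similarityPerm c hc R v})

/-- A permutation of `ℝ^d ∪ {∞}` is a Möbius transformation if it lies in `moebiusGroup d`.
(Di Francesco–Mathieu–Sénéchal 1997, §4.1.) [cite: FrancescoMathieuSenechal1997, §4.1] -/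
def IsMoebius (φ : Equiv.Perm (OnePoint (EuclideanSpace ℝ (Fin d)))) : Prop :=
  φ ∈ moebiusGroup d

/-- The unit inversion is a Möbius transformation. (Di Francesco–Mathieu–Sénéchal 1997, §4.1.) [cite: FrancescoMathieuSenechal1997, §4.1] -/
theorem isMoebius_inversionPerm (d : ℕ) : IsMoebius (inversionPerm d) :=
  Subgroup.subset_closure (Or.inl rfl)

/-- Similarities are Möbius transformations. (Di Francesco–Mathieu–Sénéchal 1997, §4.1.) [cite: FrancescoMathieuSenechal1997, §4.1] -/
theorem isMoebius_similarityPerm (c : ℝ) (hc : c ≠ 0)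
    (R : EuclideanSpace ℝ (Fin d) ≃ₗᵢ[ℝ] EuclideanSpace ℝ (Fin d)) (v : EuclideanSpace ℝ (Fin d)) :
    IsMoebius (similarityPerm c hc R v) :=
  Subgroup.subset_closure (Or.inr ⟨c, hc, R, v, rfl⟩)

/-! ### Planar conformal covariance -/

/-- A planar family of `n`-point functions indexed by a domain `Ω ⊆ ℂ`: `S Ω n (a₁, …, aₙ)`, e.g.
the CHI limits `⟨σ_{a₁} ⋯ σ_{aₙ}⟩_Ω^+`. (Chelkak–Hongler–Izyurov, Ann. Math. 181 (2015),
Thm 1.1–1.2.) [folklore] -/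
abbrev PlanarCorrFamily : Type := Set ℂ → (n : ℕ) → (Fin n → ℂ) → ℝ

/-- `φ` is a conformal bijection of `Ω` onto `Ω'`: holomorphic on `Ω` and bijective `Ω → Ω'`
(for open `Ω` injectivity forces `φ' ≠ 0`, so `φ` is conformal). (Chelkak–Hongler–Izyurov 2015,
Thm 1.2, "conformal map `φ : Ω → Ω'`".) [cite: ChelkakHonglerIzyurov2015, Thm 1.2  "conformal map  φ : Ω → Ω' "] -/
def IsConformalBijection (φ : ℂ → ℂ) (Ω Ω' : Set ℂ) : Prop :=
  DifferentiableOn ℂ φ Ω ∧ Set.BijOn φ Ω Ω'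

/-- Admissible planar domains: bounded, nonempty, open and simply connected subsets of `ℂ`.
(Chelkak–Hongler–Izyurov 2015, §1, "bounded simply connected domain `Ω`"; Mathlib
`IsSimplyConnected`.) [cite: ChelkakHonglerIzyurov2015, §1  "bounded simply connected domain  Ω] -/
def IsAdmissibleDomain (Ω : Set ℂ) : Prop :=
  IsOpen Ω ∧ Bornology.IsBounded Ω ∧ Ω.Nonempty ∧ IsSimplyConnected Ω

/-- Planar conformal covariance with scaling dimension `Δ`: for all admissible domains `Ω, Ω'`,
every conformal bijection `φ : Ω → Ω'` and all distinct `a₁, …, aₙ ∈ Ω`,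
`S Ω' n (φ a₁, …, φ aₙ) = (∏ᵢ |φ'(aᵢ)|^{-Δ}) · S Ω n (a₁, …, aₙ)`.
(Chelkak–Hongler–Izyurov, Ann. Math. 181 (2015), Thm 1.2 with `Δ = 1/8`.) [folklore] -/
def IsConformallyCovariant (Δ : ℝ) (S : PlanarCorrFamily) : Prop :=
  ∀ (Ω Ω' : Set ℂ) (φ : ℂ → ℂ), IsAdmissibleDomain Ω → IsAdmissibleDomain Ω' →
    IsConformalBijection φ Ω Ω' → ∀ n (a : Fin n → ℂ), Function.Injective a → (∀ i, a i ∈ Ω) →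
      S Ω' n (fun i => φ (a i)) = (∏ i, ‖deriv φ (a i)‖ ^ (-Δ)) * S Ω n a

end Literature.Probability.LatticeModels
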